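import Summits.NavierStokesRegularity.NavierStokesRegularity.Theorems.TypeICertificateLadderTargetAmplitudeSlab
import Summits.NavierStokesRegularity.NavierStokesRegularity.Theorems.TypeICertificateLadderTargetStrainCubeGalilean
import HarnessLib

/-!
# Crux `Target` = `TypeICertificateLadder.NoTypeIBlowup` (stmt-NavierStokesRegularity-1217), line
# `depletion-ladder`: THE LOG-INTEGRAL RUNG — a quantitative Prodi–Serrin `L²ₜL^∞ₓ` divergence with
# explicit constant, in Galilean (oscillation) currency

`--supports stmt-NavierStokesRegularity-1217` (consumer of `…AmplitudeSlab.lean` and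
`…StrainCubeGalilean.lean`; strengthens the landed rung of record `…StrainCubeSharpDepletion.lean`).

* `lintegral_curl_sq_le_rpow_of_logAmplitude`, `energy_add_enstrophy_le_rpow_of_logAmplitude` — for a
  classical Leray–Hopf rapidly-decaying-datum solution on `[0,T)` satisfying, for some constant `κ` and
  amplitude `m : ℝ → ℝ`, the depletion bound `|∫⟪ω(t), Du(t)ω(t)⟫| ≤ κ m(t) ‖ω(t)‖₂‖∇ω(t)‖₂` along the
  flow and the LOG-INTEGRAL bound `∫₀ᵗ m(s)² ds ≤ B + A ν log(T/(T−t))` (`t ∈ (0,T)`, `A, B ≥ 0`):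
  `‖u(t)‖₂² + ‖∇u(t)‖₂² ≤ K (T−t)^{−κ²A/2}`.
* `hasSmoothExtensionPast_of_logAmplitude` — hence a classical extension past `T` as soon as
  `κ²A < 1` (`H¹` blow-up rate, `hasSmoothExtensionPast_of_powerRate`).
* `hasSmoothExtensionPast_of_logIntegral_oscillation` — **THE LOG-INTEGRAL RUNG (unconditional).** Let
  `u` be a classical solution of the unforced Navier–Stokes system on `ℝ³ × [0,T)`, Leray–Hopf from its
  rapidly decaying datum. If for SOME choice of constants `c(t) ∈ ℝ³` and amplitudes
  `m(t) ≥ sup_x |u(t,x) − c(t)|` one has `∫₀ᵗ m(s)² ds ≤ B + A ν log(T/(T−t))` for all `t ∈ (0,T)` with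
  `((2+√3)/9)²·A < 1`, i.e. `A < 81(7 − 4√3) = 5.815…`, then `u` extends smoothly past `T`.
  Contrapositive: at a first singular time `T`, for every Galilean gauge `c(·)`,
  `∫₀ᵗ sup_x|u(s,x) − c(s)|² ds − A ν log(1/(T−t))` is unbounded above as `t ↑ T` for every `A < 5.815`
  — the Prodi–Serrin `∫₀ᵀ‖u‖²_∞ = ∞` with a RATE and a CONSTANT. The sup-form rung of record
  (`hasSmoothExtensionPast_of_rate_lt_sharp`: eventually `√(T−t)‖u(t)‖_∞ ≤ C√ν`, `C < 2.4115`) is the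
  special case `c = 0`, `m(s)² = C²ν/(T−s)` (`A = C²`); the new rung also covers rates that exceed
  `2.41` on time sets of small logarithmic density, and amplitudes measured from any moving frame.

WHAT THIS IS NOT: not the crux — above `A = 1/κ²` (log-time-average of `(T−t)‖u − c‖²_∞/ν` above
`5.815`) the descent S3 stays open; the constant is the landed `κ = (2+√3)/9`. [folklore]

References: Prodi 1959 / Serrin 1962 (`L²ₜL^∞ₓ`); Leray 1934 §§19–20; Lemarié-Rieusset (2016), Thm. 11.2;
Robinson–Rodrigo–Sadowski (2016), Lemma 8.16.
-/

noncomputable section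

open Set Filter Topology MeasureTheory
open scoped RealInnerProductSpace ENNReal NNReal Laplacian ContDiff
open Literature.Analysis.FluidPDE

namespace Summit.NavierStokesRegularity.NavierStokesRegularity.Theorems.DepletionLadder

-- the problem directory repeats the summit name (`NavierStokesRegularity/NavierStokesRegularity`)
set_option linter.dupNamespace false

open Summit.NavierStokesRegularity.NavierStokesRegularity.Theorems.RungReynoldsOne
open Summit.NavierStokesRegularity.NavierStokesRegularity.Theorems.DepletionLadder.StrainCube

/-- **Depleted enstrophy Grönwall against a log-integral amplitude.** For a classical Leray–Hopf
rapidly-decaying-datum solution on `ℝ³ × [0,T)` with the depletion bound (constant `κ`, amplitude `m`)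
along the flow on `(0,T)` and `∫₀ᵗ m² ≤ B + Aν log(T/(T−t))` (`A, B ≥ 0`), there is `K ≥ 0` with
`∫‖curl u(t)‖² ≤ K (T−t)^{−κ²A/2}` for all `t ∈ (0,T)`. [folklore] -/
theorem lintegral_curl_sq_le_rpow_of_logAmplitude {ν κ T A B : ℝ} (hν : 0 < ν) (hT : 0 < T)
    (hA : 0 ≤ A) (hB : 0 ≤ B)
    {u : ℝ → EuclideanSpace ℝ (Fin 3) → EuclideanSpace ℝ (Fin 3)}
    {p : ℝ → EuclideanSpace ℝ (Fin 3) → ℝ}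
    (hsol : IsClassicalNSSolutionOn (Ico 0 T) ν 0 u p) (hLH : IsLerayHopfOn T ν 0 (u 0) u)
    (hdec : HasRapidSpatialDecay (u 0)) {m : ℝ → ℝ}
    (hdepl : ∀ t ∈ Ioo 0 T,
      |∫ x, ⟪curl (u t) x, fderiv ℝ (u t) x (curl (u t) x)⟫| ≤
        κ * m t * Real.sqrt (∫ x, ‖curl (u t) x‖ ^ 2) *
          Real.sqrt (∫ x, frobeniusNormSq (fderiv ℝ (curl (u t)) x)))
    (hint : ∀ t ∈ Ioo 0 T, ∫⁻ s in Ioo 0 t, ENNReal.ofReal (m s ^ 2) ≤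
      ENNReal.ofReal (B + A * ν * Real.log (T / (T - t)))) :
    ∃ K : ℝ, 0 ≤ K ∧ ∀ t ∈ Ioo 0 T,
      ∫⁻ x, ‖curl (u t) x‖ₑ ^ 2 ≤ ENNReal.ofReal (K * (T - t) ^ (-(κ ^ 2 * A / 2))) := by
  -- finiteness of the enstrophy at time `0` (Tao cover at `T/2`)
  have hT2 : T / 2 ∈ Ioo 0 T := ⟨by positivity, by linarith⟩
  obtain ⟨q₀, -, hu₀, -, -⟩ := stub_taoCover hν hT hsol hLH hdec hT2
  obtain ⟨C₁, hC₁⟩ := hu₀ 1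
  have h00 : (0 : ℝ) ∈ Icc 0 (T / 2) := ⟨le_rfl, hT2.1.le⟩
  have hZ0 : ∫⁻ x, ‖curl (u 0) x‖ₑ ^ 2 ≤ 6 * C₁ := by
    calc ∫⁻ x, ‖curl (u 0) x‖ₑ ^ 2 ≤ ∫⁻ x, 6 * ‖iteratedFDeriv ℝ 1 (u 0) x‖ₑ ^ 2 :=
          lintegral_mono fun x => enorm_curl_sq_le_six_mul (u 0) x
      _ = 6 * ∫⁻ x, ‖iteratedFDeriv ℝ 1 (u 0) x‖ₑ ^ 2 := lintegral_const_mul' _ _ (by norm_num)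
      _ ≤ 6 * C₁ := by gcongr; exact hC₁ 0 h00
  have hZ0top : ∫⁻ x, ‖curl (u 0) x‖ₑ ^ 2 ≠ ⊤ :=
    (hZ0.trans_lt (ENNReal.mul_lt_top (by norm_num) ENNReal.coe_lt_top)).ne
  set Z0 : ℝ := (∫⁻ x, ‖curl (u 0) x‖ₑ ^ 2).toReal with hZ0def
  have hZ0nn : 0 ≤ Z0 := ENNReal.toReal_nonneg
  -- the constant
  set kν : ℝ := κ ^ 2 / (2 * ν) with hkν
  have hk0 : 0 ≤ kν := by positivity
  set γ : ℝ := κ ^ 2 * A / 2 with hγ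
  have hγk : kν * (A * ν) = γ := by
    rw [hkν, hγ]
    field_simp
  set K : ℝ := Real.exp (kν * B) * T ^ γ * Z0 with hK
  refine ⟨K, by positivity, fun t ht => ?_⟩
  obtain ⟨q, hsolt, hut, hutt, -⟩ := stub_taoCover hν hT hsol hLH hdec ht
  have hTt : 0 < T - t := sub_pos.2 ht.2
  have hlog : 0 ≤ Real.log (T / (T - t)) :=
    Real.log_nonneg ((one_le_div hTt).2 (by linarith [ht.1]))
  have hrhs0 : 0 ≤ B + A * ν * Real.log (T / (T - t)) := by positivity
  have hΛt := hint t ht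
  have hΛtop : ∫⁻ s in Ioo 0 t, ENNReal.ofReal (m s ^ 2) ≠ ⊤ :=
    (hΛt.trans_lt ENNReal.ofReal_lt_top).ne
  have hdepl_t : ∀ s ∈ Ioo 0 t,
      |∫ x, ⟪curl (u s) x, fderiv ℝ (u s) x (curl (u s) x)⟫| ≤
        κ * m s * Real.sqrt (∫ x, ‖curl (u s) x‖ ^ 2) *
          Real.sqrt (∫ x, frobeniusNormSq (fderiv ℝ (curl (u s)) x)) :=
    fun s hs => hdepl s ⟨hs.1, hs.2.trans ht.2⟩
  have hmain := lintegral_curl_sq_le_exp_of_amplitude hν ht.1 hsolt hut hutt hdepl_t ⟨ht.1, le_rfl⟩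
    hΛtop
  refine hmain.trans ?_
  have hexp : Real.exp (κ ^ 2 / (2 * ν) * (∫⁻ s in Ioo 0 t, ENNReal.ofReal (m s ^ 2)).toReal) ≤
      Real.exp (kν * B) * (T / (T - t)) ^ γ := by
    have h1 : (∫⁻ s in Ioo 0 t, ENNReal.ofReal (m s ^ 2)).toReal ≤
        B + A * ν * Real.log (T / (T - t)) := ENNReal.toReal_le_of_le_ofReal hrhs0 hΛt
    have h2 := Real.exp_le_exp.2 (mul_le_mul_of_nonneg_left h1 hk0)
    refine h2.trans_eq ?_
    rw [show B + A * ν * Real.log (T / (T - t)) = B + (A * ν) * Real.log (T / (T - t)) by ring,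
      exp_mul_add_mul_log (div_pos hT hTt), hγk]
  have hpow : (T / (T - t)) ^ γ = T ^ γ * (T - t) ^ (-γ) := by
    rw [Real.div_rpow hT.le hTt.le, Real.rpow_neg hTt.le, div_eq_mul_inv]
  calc ENNReal.ofReal (Real.exp (κ ^ 2 / (2 * ν) *
        (∫⁻ s in Ioo 0 t, ENNReal.ofReal (m s ^ 2)).toReal)) * ∫⁻ x, ‖curl (u 0) x‖ₑ ^ 2
      ≤ ENNReal.ofReal (Real.exp (kν * B) * (T / (T - t)) ^ γ) * ENNReal.ofReal Z0 := by
        rw [ENNReal.ofReal_toReal hZ0top]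
        gcongr
    _ = ENNReal.ofReal (K * (T - t) ^ (-γ)) := by
        rw [← ENNReal.ofReal_mul (by positivity), hpow, hK]
        ring_nf

/-- **The `H¹`-type power rate under a log-integral amplitude**: under the hypotheses of
`lintegral_curl_sq_le_rpow_of_logAmplitude`, `‖u(t)‖₂² + ‖∇u(t)‖₂² ≤ K′(T−t)^{−κ²A/2}` on `[T/2, T)`
(energy `≤ 2E(u₀)`, `∫|∇u|² ≤ ∫|curl u|²`). [folklore] -/
theorem energy_add_enstrophy_le_rpow_of_logAmplitude {ν κ T A B : ℝ} (hν : 0 < ν) (hT : 0 < T)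
    (hA : 0 ≤ A) (hB : 0 ≤ B)
    {u : ℝ → EuclideanSpace ℝ (Fin 3) → EuclideanSpace ℝ (Fin 3)}
    {p : ℝ → EuclideanSpace ℝ (Fin 3) → ℝ}
    (hsol : IsClassicalNSSolutionOn (Ico 0 T) ν 0 u p) (hLH : IsLerayHopfOn T ν 0 (u 0) u)
    (hdec : HasRapidSpatialDecay (u 0)) {m : ℝ → ℝ}
    (hdepl : ∀ t ∈ Ioo 0 T,
      |∫ x, ⟪curl (u t) x, fderiv ℝ (u t) x (curl (u t) x)⟫| ≤
        κ * m t * Real.sqrt (∫ x, ‖curl (u t) x‖ ^ 2) *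
          Real.sqrt (∫ x, frobeniusNormSq (fderiv ℝ (curl (u t)) x)))
    (hint : ∀ t ∈ Ioo 0 T, ∫⁻ s in Ioo 0 t, ENNReal.ofReal (m s ^ 2) ≤
      ENNReal.ofReal (B + A * ν * Real.log (T / (T - t)))) :
    ∃ K : ℝ, ∃ t₀ ∈ Ico 0 T, ∀ t ∈ Ico t₀ T,
      (∫⁻ x, ‖u t x‖ₑ ^ 2) + ∫⁻ x, ENNReal.ofReal (frobeniusNormSq (fderiv ℝ (u t) x)) ≤
        ENNReal.ofReal (K * (T - t) ^ (-(κ ^ 2 * A / 2))) := by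
  obtain ⟨K, hK0, hK⟩ :=
    lintegral_curl_sq_le_rpow_of_logAmplitude hν hT hA hB hsol hLH hdec hdepl hint
  set γ : ℝ := κ ^ 2 * A / 2 with hγ
  have hγ0 : 0 ≤ γ := by positivity
  set E₀ : ℝ := 2 * VectorCalculus.kineticEnergy (u 0) with hE₀
  have hE : ∀ t ∈ Icc 0 T, ∫⁻ x, ‖u t x‖ₑ ^ 2 ≤ ENNReal.ofReal (max E₀ 0) := fun t ht =>
    (hLH.lintegral_enorm_sq_le hν.le ht).trans (ENNReal.ofReal_le_ofReal (le_max_left _ _))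
  refine ⟨max E₀ 0 * T ^ γ + K, T / 2, ⟨by positivity, by linarith⟩, fun t ht => ?_⟩
  have ht' : t ∈ Ioo 0 T := ⟨lt_of_lt_of_le (by positivity) ht.1, ht.2⟩
  have htc : t ∈ Icc 0 T := ⟨ht'.1.le, ht'.2.le⟩
  have htI : t ∈ Ico 0 T := ⟨ht'.1.le, ht'.2⟩
  have hTt : 0 < T - t := sub_pos.2 ht.2
  have hL2 : ∫⁻ x, ‖u t x‖ₑ ^ 2 < ⊤ := (hE t htc).trans_lt ENNReal.ofReal_lt_top
  have hG : ∫⁻ x, ENNReal.ofReal (frobeniusNormSq (fderiv ℝ (u t) x)) ≤ ∫⁻ x, ‖curl (u t) x‖ₑ ^ 2 :=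
    lintegral_frobeniusNormSq_fderiv_le_lintegral_sq_norm_curl
      ((hsol.contDiff_velocity htI).of_le (by norm_cast)) (hsol.divFree t htI) hL2
  have hone : 1 ≤ T ^ γ * (T - t) ^ (-γ) := by
    rw [Real.rpow_neg hTt.le, ← div_eq_mul_inv, ← Real.div_rpow hT.le hTt.le]
    exact Real.one_le_rpow ((one_le_div hTt).2 (by linarith [ht'.1])) hγ0
  have hE' : max E₀ 0 ≤ max E₀ 0 * T ^ γ * (T - t) ^ (-γ) := by
    have := mul_le_mul_of_nonneg_left hone (le_max_right E₀ 0)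
    rw [mul_one] at this
    simpa [mul_assoc] using this
  calc (∫⁻ x, ‖u t x‖ₑ ^ 2) + ∫⁻ x, ENNReal.ofReal (frobeniusNormSq (fderiv ℝ (u t) x))
      ≤ ENNReal.ofReal (max E₀ 0) + ENNReal.ofReal (K * (T - t) ^ (-γ)) :=
        add_le_add (hE t htc) (hG.trans (hK t ht'))
    _ = ENNReal.ofReal (max E₀ 0 + K * (T - t) ^ (-γ)) :=
        (ENNReal.ofReal_add (le_max_right _ _) (by positivity)).symm
    _ ≤ ENNReal.ofReal ((max E₀ 0 * T ^ γ + K) * (T - t) ^ (-γ)) := by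
        refine ENNReal.ofReal_le_ofReal ?_
        rw [add_mul]
        exact add_le_add hE' le_rfl

/-- **Classical extension from a log-integral amplitude** (conditional form, any constant `κ`): under
the depletion bound with constant `κ` and amplitude `m` along the flow and
`∫₀ᵗ m² ≤ B + Aν log(T/(T−t))` with `A, B ≥ 0` and `κ²A < 1`, the solution extends smoothly past `T`
(`κ²A/2 < 1/2` in `hasSmoothExtensionPast_of_powerRate`). [folklore] -/
theorem hasSmoothExtensionPast_of_logAmplitude {ν κ T A B : ℝ} (hν : 0 < ν) (hT : 0 < T)
    (hA : 0 ≤ A) (hB : 0 ≤ B) (hκA : κ ^ 2 * A < 1)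
    {u : ℝ → EuclideanSpace ℝ (Fin 3) → EuclideanSpace ℝ (Fin 3)}
    {p : ℝ → EuclideanSpace ℝ (Fin 3) → ℝ}
    (hsol : IsClassicalNSSolutionOn (Ico 0 T) ν 0 u p) (hLH : IsLerayHopfOn T ν 0 (u 0) u)
    (hdec : HasRapidSpatialDecay (u 0)) {m : ℝ → ℝ}
    (hdepl : ∀ t ∈ Ioo 0 T,
      |∫ x, ⟪curl (u t) x, fderiv ℝ (u t) x (curl (u t) x)⟫| ≤
        κ * m t * Real.sqrt (∫ x, ‖curl (u t) x‖ ^ 2) *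
          Real.sqrt (∫ x, frobeniusNormSq (fderiv ℝ (curl (u t)) x)))
    (hint : ∀ t ∈ Ioo 0 T, ∫⁻ s in Ioo 0 t, ENNReal.ofReal (m s ^ 2) ≤
      ENNReal.ofReal (B + A * ν * Real.log (T / (T - t)))) :
    HasSmoothExtensionPast ν 0 u T := by
  have hγ : κ ^ 2 * A / 2 < 1 / 2 := by linarith
  obtain ⟨K, t₀, ht₀, hK⟩ :=
    energy_add_enstrophy_le_rpow_of_logAmplitude hν hT hA hB hsol hLH hdec hdepl hint
  exact hasSmoothExtensionPast_of_powerRate hν hT hγ hsol hLH hdec ⟨t₀, ht₀, hK⟩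

/-- **The Galilean depletion bound holds along every classical Leray–Hopf rapidly-decaying-datum
flow**, for every gauge `c(t)` and every amplitude `m(t) ≥ sup_x |u(t,x) − c(t)|`:
`|∫⟪ω(t), Du(t)ω(t)⟫| ≤ ((2+√3)/9) · m(t) · ‖ω(t)‖₂ · ‖∇ω(t)‖₂` at each `t ∈ [0,T)` (Tao cover for the
slice class, `abs_integral_stretching_le_strainCube_galilean`). [folklore] -/
theorem galilean_depletion_along_flow {ν T : ℝ} (hν : 0 < ν) (hT : 0 < T)
    {u : ℝ → EuclideanSpace ℝ (Fin 3) → EuclideanSpace ℝ (Fin 3)}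
    {p : ℝ → EuclideanSpace ℝ (Fin 3) → ℝ}
    (hsol : IsClassicalNSSolutionOn (Ico 0 T) ν 0 u p) (hLH : IsLerayHopfOn T ν 0 (u 0) u)
    (hdec : HasRapidSpatialDecay (u 0)) {c : ℝ → EuclideanSpace ℝ (Fin 3)} {m : ℝ → ℝ}
    {t : ℝ} (ht : t ∈ Ico 0 T) (hm : ∀ x, ‖u t x - c t‖ ≤ m t) :
    |∫ x, ⟪curl (u t) x, fderiv ℝ (u t) x (curl (u t) x)⟫| ≤
      (2 + Real.sqrt 3) / 9 * m t * Real.sqrt (∫ x, ‖curl (u t) x‖ ^ 2) *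
        Real.sqrt (∫ x, frobeniusNormSq (fderiv ℝ (curl (u t)) x)) := by
  have ht' : (t + T) / 2 ∈ Ioo 0 T := ⟨by linarith [ht.1], by linarith [ht.2]⟩
  obtain ⟨q, hsolt, hut, -, -⟩ := stub_taoCover hν hT hsol hLH hdec ht'
  have htI : t ∈ Icc 0 ((t + T) / 2) := ⟨ht.1, by linarith [ht.2]⟩
  obtain ⟨C₀, hC₀⟩ := hut 0
  obtain ⟨C₁, hC₁⟩ := hut 1
  obtain ⟨C₂, hC₂⟩ := hut 2
  obtain ⟨B₁, -, hB₁⟩ := exists_forall_norm_fderiv_le_of_hasBoundedSobolevNormsOn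
    (fun s hs => (hsolt.contDiff_velocity hs).of_le (by norm_cast)) hut
  have h0 : ∫⁻ x, ‖iteratedFDeriv ℝ 0 (u t) x‖ₑ ^ 2 < ⊤ := (hC₀ t htI).trans_lt ENNReal.coe_lt_top
  have h1 : ∫⁻ x, ‖iteratedFDeriv ℝ 1 (u t) x‖ₑ ^ 2 < ⊤ := (hC₁ t htI).trans_lt ENNReal.coe_lt_top
  have h2 : ∫⁻ x, ‖iteratedFDeriv ℝ 2 (u t) x‖ₑ ^ 2 < ⊤ := (hC₂ t htI).trans_lt ENNReal.coe_lt_top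
  have hv : ContDiff ℝ ∞ (u t) := hsol.contDiff_velocity ht
  have hdiv : VectorCalculus.IsDivFree (u t) := hsol.divFree t ht
  exact abs_integral_stretching_le_strainCube_galilean hv hdiv (c t) hm (hB₁ t htI) h0 h1 h2

/-- **THE LOG-INTEGRAL RUNG (Galilean currency, unconditional).** Let `u` be a classical solution of
the unforced Navier–Stokes system on `ℝ³ × [0,T)` (`ν, T > 0`), Leray–Hopf from its rapidly decaying
datum. Suppose that for some gauge `c : ℝ → ℝ³`, some amplitude `m : ℝ → ℝ` with
`|u(t,x) − c(t)| ≤ m(t)` for all `t ∈ (0,T)` and all `x`, and some `A, B ≥ 0` with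
`((2+√3)/9)²·A < 1` (`A < 81(7−4√3) = 5.815…`):
`∫₀ᵗ m(s)² ds ≤ B + A ν log(T/(T−t))` for every `t ∈ (0,T)` (lower Lebesgue integral). Then `u`
extends to a classical solution past `T`. [folklore] -/
theorem hasSmoothExtensionPast_of_logIntegral_oscillation {ν T A B : ℝ} (hν : 0 < ν) (hT : 0 < T)
    (hA : 0 ≤ A) (hB : 0 ≤ B) (hA1 : ((2 + Real.sqrt 3) / 9) ^ 2 * A < 1)
    {u : ℝ → EuclideanSpace ℝ (Fin 3) → EuclideanSpace ℝ (Fin 3)}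
    {p : ℝ → EuclideanSpace ℝ (Fin 3) → ℝ}
    (hsol : IsClassicalNSSolutionOn (Ico 0 T) ν 0 u p) (hLH : IsLerayHopfOn T ν 0 (u 0) u)
    (hdec : HasRapidSpatialDecay (u 0)) {c : ℝ → EuclideanSpace ℝ (Fin 3)} {m : ℝ → ℝ}
    (hm : ∀ t ∈ Ioo 0 T, ∀ x, ‖u t x - c t‖ ≤ m t)
    (hint : ∀ t ∈ Ioo 0 T, ∫⁻ s in Ioo 0 t, ENNReal.ofReal (m s ^ 2) ≤
      ENNReal.ofReal (B + A * ν * Real.log (T / (T - t)))) :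
    HasSmoothExtensionPast ν 0 u T :=
  hasSmoothExtensionPast_of_logAmplitude hν hT hA hB hA1 hsol hLH hdec
    (fun t ht => galilean_depletion_along_flow hν hT hsol hLH hdec ⟨ht.1.le, ht.2⟩ (hm t ht)) hint

/-- The threshold of the log-integral rung in closed form: `((2+√3)/9)² · A < 1 ↔ A < 81(7 − 4√3)`
(`(2+√3)(7−4√3)·(2+√3) = 1`; `81(7−4√3) = 5.8155…`). [folklore] -/
theorem logIntegral_threshold_iff (A : ℝ) :
    ((2 + Real.sqrt 3) / 9) ^ 2 * A < 1 ↔ A < 81 * (7 - 4 * Real.sqrt 3) := by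
  have h3 : Real.sqrt 3 * Real.sqrt 3 = 3 := Real.mul_self_sqrt (by norm_num)
  have hinv : ((2 + Real.sqrt 3) / 9) ^ 2 * (81 * (7 - 4 * Real.sqrt 3)) = 1 := by
    nlinarith [h3]
  have hpos : 0 < ((2 + Real.sqrt 3) / 9) ^ 2 := by positivity
  constructor
  · intro h
    by_contra hle
    have hle' : 81 * (7 - 4 * Real.sqrt 3) ≤ A := not_lt.mp hle
    have := mul_le_mul_of_nonneg_left hle' hpos.le
    linarith
  · intro h
    have := mul_lt_mul_of_pos_left h hpos
    linarith

/-- **All log-integral rates up to `5.81`**: with `A ≤ 5.81` (and any `B ≥ 0`, any gauge) the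
log-integral rung applies (`81(7−4√3) > 5.81` since `√3 < 1.73206`). [folklore] -/
theorem hasSmoothExtensionPast_of_logIntegral_oscillation_le {ν T A B : ℝ} (hν : 0 < ν) (hT : 0 < T)
    (hA : 0 ≤ A) (hB : 0 ≤ B) (hA1 : A ≤ 5.81)
    {u : ℝ → EuclideanSpace ℝ (Fin 3) → EuclideanSpace ℝ (Fin 3)}
    {p : ℝ → EuclideanSpace ℝ (Fin 3) → ℝ}
    (hsol : IsClassicalNSSolutionOn (Ico 0 T) ν 0 u p) (hLH : IsLerayHopfOn T ν 0 (u 0) u)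
    (hdec : HasRapidSpatialDecay (u 0)) {c : ℝ → EuclideanSpace ℝ (Fin 3)} {m : ℝ → ℝ}
    (hm : ∀ t ∈ Ioo 0 T, ∀ x, ‖u t x - c t‖ ≤ m t)
    (hint : ∀ t ∈ Ioo 0 T, ∫⁻ s in Ioo 0 t, ENNReal.ofReal (m s ^ 2) ≤
      ENNReal.ofReal (B + A * ν * Real.log (T / (T - t)))) :
    HasSmoothExtensionPast ν 0 u T := by
  have h3 : Real.sqrt 3 < 1.73206 := by
    rw [Real.sqrt_lt' (by norm_num)]; norm_num
  have hA1' : A < 81 * (7 - 4 * Real.sqrt 3) := by linarith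
  exact hasSmoothExtensionPast_of_logIntegral_oscillation hν hT hA hB
    ((logIntegral_threshold_iff A).2 hA1') hsol hLH hdec hm hint

end Summit.NavierStokesRegularity.NavierStokesRegularity.Theorems.DepletionLadder

end
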